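/-
Copyright: cell `pub-ymgap` (HUMAN RULING D-0062), Track A of `YM-PLAN.md`, DAG node N20 (= NE7b); R134 seat `pub-ymgap-dag-n20-d`
(strategy s3 «alternative currency», generation 5), module 1 of 2.  Released under the licence of the surrounding project.
-/
import Summits.QuantumFields.BalabanUV.T4Continuum.Spine.NE7b.LocalConditionalStability
import Summits.QuantumFields.BalabanUV.T4Continuum.Support.ShellMeasureAverageIterate
import HarnessLib

/-!
# YM-DAG node N20 (= NE7b), strategy s3, THE FOURTH CURRENCY «BY VALUE» (module 1 of 2): BY-VALUE TELESCOPING — on a history tower whose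
# one-step operations have the MODULE PROPERTY over level maps `avg j : C j → C (j+1)`, the level-`K` integral of every history term IS the
# level-0 integral of `ρ₀` against the history's characteristic functions PULLED BACK along the iterated level maps; a pattern class's partial
# sum IS the level-0 integral of the sum of its pull-backs; the full sum IS `∫ ρ₀ dμ_0` by the decomposition of unity alone

Track A of `YM-PLAN.md` (cell `pub-ymgap`, HUMAN RULING D-0062), node **N20** = spine estimate NE7b (`T4WeightBudget.RelWeightBound` — the cell
`pub-balaban`'s OWN estimate, NOT PRINTED in [Bałaban 1983–89], NOT PROVED).  Seat `pub-ymgap-dag-n20-d` (director-ym R134 row «W_K < 1, Σ W_K < ∞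
… (alternative currency)»), generation 5.  Kernel theorems over the TREE's abstract history tower (`B16HistoryReprChain.Tower`, IR-97-2) and gaps-ne6's
pattern classes (`PrefixExtraction.admS`): 1 bookkeeping `def` (the pulled-back product `pullAlong` — no object of Bałaban's), 0 `sorry`, standard
axioms; COUNT-NEUTRAL (`--supports` K3‴ `SpineGivenEndpointR13`, stmt-QuantumFields-19912, `--as helper`).  Restate-immune (no Theses import).
Module 2 (`…N20ByValueExtraction`) draws the consequence for the (α) road's per-class display and the junction to NODE 00's T-step of record.

THE MODULE PROPERTY (the one structural hypothesis, DISPLAYED as `hmod`, never claimed for any tower of Bałaban's).  A one-step operation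
`op j g p : (C j → ℝ) → (C (j+1) → ℝ)` of the tower is a MODULE STEP over the level map `avg j` with the `hstep`-characteristic function `χ_{j,g,p}`
when, for all good `m : C (j+1) → ℝ` and `f : C j → ℝ`,
  `∫ m·(op j g p).T f dμ_{j+1} = ∫ (m ∘ avg j)·(χ_{j,g,p}·f) dμ_j`
— IR-102-1's per-(step, choice) integral identity `hstep` is the case `m = 1`; the module form says in addition that the step integrates over the
FIBRES of `avg j`, so multiplication by a function of the NEW field commutes with it.  That is the structure of a pure 𝐓-step («integrate the old
field against `δ(V − M(U))`», [Balaban1989LargeFieldI] (0.4) p. 176 — LOCATOR): for NODE 00's T-step of record (the disintegration transport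
`T4AveragingDisintegration.kernelTransport`) it is n20-c's `N20LCSPushforward.integral_mul_kernelTransport` (module 2 §2 types the junction); whether
the 𝐑-terms of [Balaban1989LargeFieldI] (0.3) read as tower operations have it is (A1c) DATA (NC-NE7b-α UNRULED) — not touched.

WHAT THIS FILE PROVES (all [folklore]: finite sums and the displayed identity; nothing of Bałaban's named).
* §1 (the iterated level map `iterMap avg j : C 0 → C j` is the TREE's `ShellMeasureAverageIterate.iterMap`, reused) `pullAlong avg χ K h : C 0 → ℝ` = `Tower.wAlong` of the factors
  `χ_{j, h|_j, h_j} ∘ iterMap j` (the history's characteristic functions PULLED BACK to level 0); `pullAlong_zero ∕ _succ ∕ _snoc ∕ _nonneg`;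
  class bookkeeping `good_comp_iterMap`, `pullAlong_good`, `good_prod_iterMap` under `havg : m good ⇒ m ∘ avg j good`.
* §2 ★★ `integral_mul_eterm_eq_pullAlong`: for `h ∈ adm K` and good `m`, `∫ m·eterm K h dμ_K = ∫ (m ∘ iterMap K)·(pullAlong K h·ρ₀) dμ_0`
  (induction on `K`, one use of `hmod` per step with the good weight `(m ∘ avg K)·χ_{K,g,p}`); `integral_eterm_eq_pullAlong` (`m = 1`);
  ★ `sum_admS_integral_eterm_eq` (`Σ_{h ∈ admS K} ∫ eterm K h dμ_K = ∫ (Σ_{admS K} pullAlong K h)·ρ₀ dμ_0`); `sum_adm_pullAlong_eq_one`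
  (`hunit` ⟹ `Σ_{adm K} pullAlong K h ≡ 1`) and ★ `sum_adm_integral_eterm_eq` (the FULL sum is `∫ ρ₀ dμ_0` — `Tower.integral_dens_eq` with its
  `hpres`∕`hint`∕`hint'` displays replaced by `hmod` + `hunit` + «good level-0 functions are `μ_0`-integrable»).
* §3 Sanity (decided toy; says NOTHING about Bałaban's objects): on `B16HistoryReprInstance.toyT` (one-point levels, `true ↦ ×2`, `false ↦ ×3`;
  Dirac levels, `avg = id`, gaps-ne6's `LocalConditionalStability.toyχ`: `χ true = 2`, `χ false = 3`) THE MODULE PROPERTY HOLDS (`toy_hmod`), the pattern class of `PrefixExtractionLaws.toyS`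
  (step 0 pinned to `false`) pulls back to `3·2 + 3·3 = 15` (`toy_sum_pullAlong`), and `sum_admS_integral_eterm_eq` reproduces the class's term
  sum `15` of `PrefixExtractionLaws.toy_sum_admS` AT LEVEL 0 — (A)∕(B) jointly non-vacuous.

HONEST FRAMING.  Count-neutral kernel bookkeeping; nothing of Bałaban's is asserted, valued or instantiated; which towers are Bałaban's is (A1c)
DATA; NE7b NOT PRINTED ∕ NOT PROVED; the (α)-instance 0∕1; N20 NOT discharged (typed 28∕28, discharged count untouched); one finite four-torus
programme at fixed `ε` — NOT ℝ⁴, NOT infinite volume, NOT OS, NOT a mass gap, NOT Clay.  References (LOCATORS only; no decl carries a cite tag):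
T. Bałaban, CMP **122** (1989) 175–202 [Balaban1989LargeFieldI] ((0.3)–(0.5), (0.4) p. 176); CMP **122** (1989) 355–392 [Balaban1989LargeFieldII]
((1.71)∕(1.72) p. 378–379).
-/

set_option autoImplicit false

noncomputable section

open Finset MeasureTheory
open Summit.QuantumFields.BalabanUV.T4Continuum.B16HistoryIndexedRepr
open Summit.QuantumFields.BalabanUV.T4Continuum.B16HistoryReprChain
open Summit.QuantumFields.BalabanUV.T4Continuum.B16HistoryReprInstance (toyT toyOps toyOp)
open Summit.QuantumFields.BalabanUV.T4Continuum.NE7b.PrefixExtraction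
  (admS mem_admS_succ admS_subset_adm sum_admS_succ admS_eq_adm_of_forall eterm_snoc)
open Summit.QuantumFields.BalabanUV.T4Continuum.NE7b.PrefixExtractionLaws (toyS toy_sum_admS)
open Summit.QuantumFields.BalabanUV.T4Continuum.NE7b.LocalConditionalStability (toyχ)
open Summit.QuantumFields.BalabanUV.T4Continuum.ShellMeasureAverageIterate (iterMap iterMap_zero iterMap_succ)

namespace Summit.QuantumFields.YangMills.BalabanUVNodes.N20ByValueTelescoping

variable {P : Type} [DecidableEq P] {C : ℕ → Type} {𝒢 : (j : ℕ) → GoodClass (C j)}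

/-! ## §1 The pulled-back characteristic functions of a history (over the tree's iterated level map `ShellMeasureAverageIterate.iterMap`) -/

section Carriers

variable (avg : (j : ℕ) → C j → C (j + 1))

variable (χ : (j : ℕ) → (Fin j → P) → P → C j → ℝ)

/-- **THE PULLED-BACK CHARACTERISTIC FUNCTIONS OF A HISTORY**: `pullAlong avg χ K h y = Π_{j<K} χ_{j, h|_j, h_j}(iterMap avg j y)` — the
product of the history's `hstep`-characteristic functions, each read on the level-0 configuration `y` through the iterated level map
(`Tower.wAlong` of the `y`-dependent factors). [folklore] -/
def pullAlong (K : ℕ) (h : Fin K → P) (y : C 0) : ℝ :=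
  Tower.wAlong (fun j g p => χ j g p (iterMap avg j y)) K h

omit [DecidableEq P] in
/-- The empty history pulls back to `1`. [folklore] -/
@[simp] theorem pullAlong_zero (h : Fin 0 → P) (y : C 0) : pullAlong avg χ 0 h y = 1 := rfl

omit [DecidableEq P] in
/-- One more step: `pullAlong (K+1) h = pullAlong K h|_K · χ_{K, h|_K, h_K} ∘ iterMap K`. [folklore] -/
theorem pullAlong_succ (K : ℕ) (h : Fin (K + 1) → P) (y : C 0) :
    pullAlong avg χ (K + 1) h y = pullAlong avg χ K (Fin.init h) y * χ K (Fin.init h) (h (Fin.last K)) (iterMap avg K y) := rfl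

omit [DecidableEq P] in
/-- At an appended choice: `pullAlong (K+1) (g, p) = pullAlong K g · χ_{K,g,p} ∘ iterMap K`. [folklore] -/
theorem pullAlong_snoc (K : ℕ) (g : Fin K → P) (p : P) (y : C 0) :
    pullAlong avg χ (K + 1) (Fin.snoc g p) y = pullAlong avg χ K g y * χ K g p (iterMap avg K y) := by
  rw [pullAlong_succ, Fin.init_snoc, Fin.snoc_last]

omit [DecidableEq P] in
/-- Non-negative characteristic functions pull back to a non-negative product. [folklore] -/
theorem pullAlong_nonneg (hχ0 : ∀ j g p y, 0 ≤ χ j g p y) (K : ℕ) (h : Fin K → P) (y : C 0) : 0 ≤ pullAlong avg χ K h y :=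
  Tower.wAlong_nonneg _ (fun j g p => hχ0 j g p _) K h

variable {avg}

omit [DecidableEq P] in
/-- **CLASS BOOKKEEPING**: if each level map pulls good functions back to good functions (`havg`), so does the iterated map down to level `0`.
[folklore] -/
theorem good_comp_iterMap (havg : ∀ (j : ℕ) (m : C (j + 1) → ℝ), (𝒢 (j + 1)).Gd m → (𝒢 j).Gd (fun y => m (avg j y))) :
    ∀ (j : ℕ) (m : C j → ℝ), (𝒢 j).Gd m → (𝒢 0).Gd (fun y => m (iterMap avg j y))
  | 0, _, hm => hm
  | j + 1, m, hm => good_comp_iterMap havg j (fun z => m (avg j z)) (havg j m hm)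

variable {χ}

omit [DecidableEq P] in
/-- The pulled-back product of good characteristic functions is good at level `0`. [folklore] -/
theorem pullAlong_good (havg : ∀ (j : ℕ) (m : C (j + 1) → ℝ), (𝒢 (j + 1)).Gd m → (𝒢 j).Gd (fun y => m (avg j y)))
    (hχ : ∀ j g p, (𝒢 j).Gd (χ j g p)) : ∀ (K : ℕ) (h : Fin K → P), (𝒢 0).Gd (pullAlong avg χ K h)
  | 0, _ => (𝒢 0).const 1
  | K + 1, h => by
      show (𝒢 0).Gd fun y => pullAlong avg χ K (Fin.init h) y * χ K (Fin.init h) (h (Fin.last K)) (iterMap avg K y)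
      exact (𝒢 0).mul (pullAlong_good havg hχ K (Fin.init h)) (good_comp_iterMap havg K _ (hχ K (Fin.init h) (h (Fin.last K))))

omit [DecidableEq P] in
/-- The product of good per-level letters read through the iterated maps is good at level `0`. [folklore] -/
theorem good_prod_iterMap (havg : ∀ (j : ℕ) (m : C (j + 1) → ℝ), (𝒢 (j + 1)).Gd m → (𝒢 j).Gd (fun y => m (avg j y)))
    {e : (j : ℕ) → C j → ℝ} (he : ∀ j, (𝒢 j).Gd (e j)) :
    ∀ K : ℕ, (𝒢 0).Gd fun y => ∏ j ∈ Finset.range K, e j (iterMap avg j y)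
  | 0 => by simpa only [Finset.prod_range_zero] using (𝒢 0).const 1
  | K + 1 => by
      simpa only [Finset.prod_range_succ] using (𝒢 0).mul (good_prod_iterMap havg he K) (good_comp_iterMap havg K _ (he K))

end Carriers

/-! ## §2 BY-VALUE TELESCOPING under the module property -/

section Telescoping

variable (T : Tower P C 𝒢) [∀ j, MeasurableSpace (C j)] (μ : (j : ℕ) → Measure (C j))
  (avg : (j : ℕ) → C j → C (j + 1)) (χ : (j : ℕ) → (Fin j → P) → P → C j → ℝ)

omit [DecidableEq P] in
/-- **BY-VALUE TELESCOPING.**  On a tower whose admissible one-step operations have the MODULE PROPERTY over the level maps `avg j` with the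
`hstep`-characteristic functions `χ_{j,g,p}` — `∫ m·(op j g p).T f dμ_{j+1} = ∫ (m ∘ avg j)·(χ_{j,g,p}·f) dμ_j` for good `m`, `f` — the level-`K`
integral of every admissible history term against a good weight `m` IS the level-0 integral of `ρ₀` times the pulled-back characteristic
functions of the history, weighted by `m ∘ iterMap K`:
`∫ m·eterm K h dμ_K = ∫ (m ∘ iterMap K)·(pullAlong K h·ρ₀) dμ_0`.  Induction on `K`, one use of `hmod` per step (with the good weight
`(m ∘ avg K)·χ_{K,g,p}`). [folklore] -/
theorem integral_mul_eterm_eq_pullAlong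
    (havg : ∀ (j : ℕ) (m : C (j + 1) → ℝ), (𝒢 (j + 1)).Gd m → (𝒢 j).Gd (fun y => m (avg j y)))
    (hχ : ∀ j g p, (𝒢 j).Gd (χ j g p))
    (hmod : ∀ (j : ℕ) (g : Fin j → P) (p : P), g ∈ T.adm j → p ∈ T.branch j g → ∀ (m : C (j + 1) → ℝ) (f : C j → ℝ),
      (𝒢 (j + 1)).Gd m → (𝒢 j).Gd f →
        ∫ x, m x * (T.op j g p).T f x ∂μ (j + 1) = ∫ y, m (avg j y) * (χ j g p y * f y) ∂μ j)
    {ρ₀ : C 0 → ℝ} (hρ : (𝒢 0).Gd ρ₀) :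
    ∀ (K : ℕ) (h : Fin K → P), h ∈ T.adm K → ∀ (m : C K → ℝ), (𝒢 K).Gd m →
      ∫ x, m x * T.eterm ρ₀ K h x ∂μ K = ∫ y, m (iterMap avg K y) * (pullAlong avg χ K h y * ρ₀ y) ∂μ 0
  | 0, h, _, m, _ => by
      simp only [Tower.eterm, iterMap_zero, pullAlong_zero, one_mul]
  | K + 1, h, hh, m, hm => by
      obtain ⟨hg, hp⟩ := (T.mem_adm_succ h).1 hh
      have hm' : (𝒢 K).Gd (fun y => m (avg K y) * χ K (Fin.init h) (h (Fin.last K)) y) :=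
        (𝒢 K).mul (havg K m hm) (hχ K _ _)
      calc ∫ x, m x * T.eterm ρ₀ (K + 1) h x ∂μ (K + 1)
          = ∫ x, m x * (T.op K (Fin.init h) (h (Fin.last K))).T (T.eterm ρ₀ K (Fin.init h)) x ∂μ (K + 1) := rfl
        _ = ∫ y, m (avg K y) * (χ K (Fin.init h) (h (Fin.last K)) y * T.eterm ρ₀ K (Fin.init h) y) ∂μ K :=
            hmod K _ _ hg hp m _ hm (T.eterm_good hρ K _)
        _ = ∫ y, (m (avg K y) * χ K (Fin.init h) (h (Fin.last K)) y) * T.eterm ρ₀ K (Fin.init h) y ∂μ K := by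
            simp_rw [mul_assoc]
        _ = ∫ z, (m (avg K (iterMap avg K z)) * χ K (Fin.init h) (h (Fin.last K)) (iterMap avg K z)) *
              (pullAlong avg χ K (Fin.init h) z * ρ₀ z) ∂μ 0 :=
            integral_mul_eterm_eq_pullAlong havg hχ hmod hρ K (Fin.init h) hg _ hm'
        _ = ∫ z, m (iterMap avg (K + 1) z) * (pullAlong avg χ (K + 1) h z * ρ₀ z) ∂μ 0 := by
            refine integral_congr_ae (Filter.Eventually.of_forall fun z => ?_)
            simp only [iterMap_succ, pullAlong_succ]
            ring

omit [DecidableEq P] in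
/-- **THE HISTORY TERM'S INTEGRAL, BY VALUE**: `∫ eterm K h dμ_K = ∫ pullAlong K h·ρ₀ dμ_0` (the weight `m = 1`). [folklore] -/
theorem integral_eterm_eq_pullAlong
    (havg : ∀ (j : ℕ) (m : C (j + 1) → ℝ), (𝒢 (j + 1)).Gd m → (𝒢 j).Gd (fun y => m (avg j y)))
    (hχ : ∀ j g p, (𝒢 j).Gd (χ j g p))
    (hmod : ∀ (j : ℕ) (g : Fin j → P) (p : P), g ∈ T.adm j → p ∈ T.branch j g → ∀ (m : C (j + 1) → ℝ) (f : C j → ℝ),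
      (𝒢 (j + 1)).Gd m → (𝒢 j).Gd f →
        ∫ x, m x * (T.op j g p).T f x ∂μ (j + 1) = ∫ y, m (avg j y) * (χ j g p y * f y) ∂μ j)
    {ρ₀ : C 0 → ℝ} (hρ : (𝒢 0).Gd ρ₀) (K : ℕ) (h : Fin K → P) (hh : h ∈ T.adm K) :
    ∫ x, T.eterm ρ₀ K h x ∂μ K = ∫ y, pullAlong avg χ K h y * ρ₀ y ∂μ 0 := by
  have e := integral_mul_eterm_eq_pullAlong T μ avg χ havg hχ hmod hρ K h hh (fun _ => 1) ((𝒢 K).const 1)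
  simpa only [one_mul] using e

variable (S : (j : ℕ) → (Fin j → P) → Finset P)

/-- **THE PATTERN CLASS'S PARTIAL SUM, BY VALUE**: `Σ_{h ∈ admS K} ∫ eterm K h dμ_K = ∫ (Σ_{h ∈ admS K} pullAlong K h)·ρ₀ dμ_0` — the
class weight at level `K` is the level-0 integral of `ρ₀` against the SUM of the pulled-back characteristic functions of the class's histories
(`hint0`: good level-0 functions are `μ_0`-integrable — `B16HistoryReprChain.integrable_of_bddMeas` in the model class). [folklore] -/
theorem sum_admS_integral_eterm_eq
    (havg : ∀ (j : ℕ) (m : C (j + 1) → ℝ), (𝒢 (j + 1)).Gd m → (𝒢 j).Gd (fun y => m (avg j y)))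
    (hχ : ∀ j g p, (𝒢 j).Gd (χ j g p))
    (hmod : ∀ (j : ℕ) (g : Fin j → P) (p : P), g ∈ T.adm j → p ∈ T.branch j g → ∀ (m : C (j + 1) → ℝ) (f : C j → ℝ),
      (𝒢 (j + 1)).Gd m → (𝒢 j).Gd f →
        ∫ x, m x * (T.op j g p).T f x ∂μ (j + 1) = ∫ y, m (avg j y) * (χ j g p y * f y) ∂μ j)
    {ρ₀ : C 0 → ℝ} (hρ : (𝒢 0).Gd ρ₀) (hint0 : ∀ f : C 0 → ℝ, (𝒢 0).Gd f → Integrable f (μ 0)) (K : ℕ) :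
    ∑ h ∈ admS T S K, ∫ x, T.eterm ρ₀ K h x ∂μ K = ∫ y, (∑ h ∈ admS T S K, pullAlong avg χ K h y) * ρ₀ y ∂μ 0 := by
  calc ∑ h ∈ admS T S K, ∫ x, T.eterm ρ₀ K h x ∂μ K = ∑ h ∈ admS T S K, ∫ y, pullAlong avg χ K h y * ρ₀ y ∂μ 0 :=
        Finset.sum_congr rfl fun h hh =>
          integral_eterm_eq_pullAlong T μ avg χ havg hχ hmod hρ K h (admS_subset_adm T S K hh)
    _ = ∫ y, ∑ h ∈ admS T S K, pullAlong avg χ K h y * ρ₀ y ∂μ 0 :=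
        (integral_finsetSum _ fun h _ => hint0 _ ((𝒢 0).mul (pullAlong_good havg hχ K h) hρ)).symm
    _ = ∫ y, (∑ h ∈ admS T S K, pullAlong avg χ K h y) * ρ₀ y ∂μ 0 := by
        simp_rw [Finset.sum_mul]

omit [DecidableEq P] [∀ j, MeasurableSpace (C j)] in
/-- **THE DECOMPOSITION OF UNITY SUMS THE PULL-BACKS TO ONE**: if after every admissible history the characteristic functions of the admissible
next choices sum to `1` pointwise (`hunit`, IR-102-1), then `Σ_{h ∈ adm K} pullAlong K h ≡ 1`. [folklore] -/
theorem sum_adm_pullAlong_eq_one (hunit : ∀ (j : ℕ) (g : Fin j → P), g ∈ T.adm j → ∀ y, ∑ p ∈ T.branch j g, χ j g p y = 1) :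
    ∀ (K : ℕ) (y : C 0), ∑ h ∈ T.adm K, pullAlong avg χ K h y = 1
  | 0, y => by
      show ∑ h ∈ (Finset.univ : Finset (Fin 0 → P)), pullAlong avg χ 0 h y = 1
      rw [Finset.univ_unique, Finset.sum_singleton, pullAlong_zero]
  | K + 1, y => by
      rw [T.sum_adm_succ]
      calc ∑ g ∈ T.adm K, ∑ p ∈ T.branch K g, pullAlong avg χ (K + 1) (Fin.snoc g p) y
          = ∑ g ∈ T.adm K, pullAlong avg χ K g y * ∑ p ∈ T.branch K g, χ K g p (iterMap avg K y) := by
            refine Finset.sum_congr rfl fun g _ => ?_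
            rw [Finset.mul_sum]
            exact Finset.sum_congr rfl fun p _ => pullAlong_snoc avg χ K g p y
        _ = ∑ g ∈ T.adm K, pullAlong avg χ K g y :=
            Finset.sum_congr rfl fun g hg => by rw [hunit K g hg, mul_one]
        _ = 1 := sum_adm_pullAlong_eq_one hunit K y

/-- **THE FULL SUM IS `∫ ρ₀ dμ_0`** from the module property and the decomposition of unity alone (`Tower.integral_dens_eq` with its
termwise-preservation and integrability displays `hpres`∕`hint`∕`hint'` REPLACED by `hmod` + `hunit` + `hint0`). [folklore] -/
theorem sum_adm_integral_eterm_eq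
    (havg : ∀ (j : ℕ) (m : C (j + 1) → ℝ), (𝒢 (j + 1)).Gd m → (𝒢 j).Gd (fun y => m (avg j y)))
    (hχ : ∀ j g p, (𝒢 j).Gd (χ j g p))
    (hmod : ∀ (j : ℕ) (g : Fin j → P) (p : P), g ∈ T.adm j → p ∈ T.branch j g → ∀ (m : C (j + 1) → ℝ) (f : C j → ℝ),
      (𝒢 (j + 1)).Gd m → (𝒢 j).Gd f →
        ∫ x, m x * (T.op j g p).T f x ∂μ (j + 1) = ∫ y, m (avg j y) * (χ j g p y * f y) ∂μ j)
    {ρ₀ : C 0 → ℝ} (hρ : (𝒢 0).Gd ρ₀) (hint0 : ∀ f : C 0 → ℝ, (𝒢 0).Gd f → Integrable f (μ 0))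
    (hunit : ∀ (j : ℕ) (g : Fin j → P), g ∈ T.adm j → ∀ y, ∑ p ∈ T.branch j g, χ j g p y = 1) (K : ℕ) :
    ∑ h ∈ T.adm K, ∫ x, T.eterm ρ₀ K h x ∂μ K = ∫ y, ρ₀ y ∂μ 0 := by
  have e := sum_admS_integral_eterm_eq T μ avg χ (fun j g => T.branch j g) havg hχ hmod hρ hint0 K
  rw [admS_eq_adm_of_forall (T := T) (S := fun j g => T.branch j g) (fun _ _ => subset_rfl) K] at e
  rw [e]
  refine integral_congr_ae (Filter.Eventually.of_forall fun y => ?_)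
  show (∑ h ∈ T.adm K, pullAlong avg χ K h y) * ρ₀ y = ρ₀ y
  rw [sum_adm_pullAlong_eq_one T avg χ hunit K y, one_mul]

end Telescoping

/-! ## §3 Sanity (decided toy; says NOTHING about Bałaban's objects): the module property and by-value telescoping on `toyT` -/

section Sanity

/-- (S0) THE MODULE PROPERTY HOLDS ON THE TOY (level maps `id`, Dirac levels): `∫ m·(×c) f dδ = ∫ (m ∘ id)·(c·f) dδ`. [folklore] -/
theorem toy_hmod : ∀ (j : ℕ) (g : Fin j → Bool) (p : Bool), g ∈ toyT.adm j → p ∈ toyT.branch j g →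
    ∀ (m f : Unit → ℝ), (GoodClass.top Unit).Gd m → (GoodClass.top Unit).Gd f →
      ∫ x, m x * (toyT.op j g p).T f x ∂(Measure.dirac ()) = ∫ y, m (id y) * (toyχ j g p y * f y) ∂(Measure.dirac ()) := by
  intro j g p _ _ m f _ _
  cases p <;> simp [toyT, toyOps, toyOp, toyχ]

/-- (S1) BY VALUE, the pattern class of `toyS` (step `0` pinned to `false`, step `1` free) pulls back to `3·2 + 3·3 = 15` at the one point —
the term sum `PrefixExtractionLaws.toy_sum_admS`, reproduced at level `0`. [folklore] -/
theorem toy_sum_pullAlong : ∑ h ∈ admS toyT toyS 2, pullAlong (C := fun _ => Unit) (fun _ => id) toyχ 2 h () = 15 := by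
  rw [sum_admS_succ, sum_admS_succ]
  simp [admS, toyS, toyT, toyχ, pullAlong_snoc, pullAlong_zero]
  norm_num

/-- (S2) THE TELESCOPED CLASS SUM ON THE TOY: `Σ_{admS 2} ∫ eterm dδ = ∫ (Σ pullAlong)·1 dδ (= 15)` by `sum_admS_integral_eterm_eq` with the
toy's module property — non-vacuous, and consistent with `toy_sum_admS`. [folklore] -/
example : ∑ h ∈ admS toyT toyS 2, ∫ x, toyT.eterm (fun _ => (1 : ℝ)) 2 h x ∂(Measure.dirac ()) = 15 := by
  rw [sum_admS_integral_eterm_eq toyT (fun _ => Measure.dirac ()) (fun _ => id) toyχ toyS (fun _ _ h => h) (fun _ _ _ => trivial)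
    toy_hmod trivial (fun f _ => Integrable.of_finite) 2]
  simp only [integral_dirac, mul_one]
  exact toy_sum_pullAlong

end Sanity

end Summit.QuantumFields.YangMills.BalabanUVNodes.N20ByValueTelescoping
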